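/-
Copyright (c) 2026 the pub-hodgecm-mathlib formalisation cell (harness21).  Prover seat hodgecm-mathlib-B-p14 (g42): sequel (cheap half) of the ENTRY BRICK
«WILD QUADRATIC CONDUCTOR» ★ `WildQuadraticNormsNearOne` (LH4-plan (g3) WORDs #25∕#30∕#31; census F0P3a-p06 (g17) `DUNR-H2-CENSUS.md` §3); 2026-09-02.
-/
import Literature.NumberTheory.LocalFields.WildQuadraticNormsNearOne   -- ★ Hensel kernel `exists_valued_lt_one_mul_self_add_mul_eq`, (W1)–(W4), `finite_residueField_adicCompletion`
import HarnessLib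

/-!
# Wild quadratic norms — EXACTNESS: symbol symmetry, the depth of squares, rigidity of an odd defect, and the exact conductor `2·ord 2 + 1`
# of `K(√u)∕K` for `u` of odd order (`1 + 4η ∉ N(K(√u)^×)` iff `η̄ ∉ ℘(𝓀)`; O'Meara §63A–B)

Topic `NumberTheory/LocalFields`; namespace `Literature.NumberTheory.LocalFields`.  THEOREMS ONLY (no definition, no instance, no notation, no named fact, no `sorry`);
CM-free; kernel lane `--supports stmt-HodgeConjecture-24833`.  Cell `pub/hodgecm-mathlib` (D-0151), crux H413 = `stmt-HodgeConjecture-24833`; half A line LH4, DYADIC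
pay-down leaf `Cruxes/H413/Lines/F0_P3c_DyadicPaydown.lean`, organs (D-UNR)∕(D-RAM) (PRINT this week; census F0P3a-p06 (g17) OUTCOME B: the wall is the wild quadratic
conductor).  Sequel of ★ `WildQuadraticNormsNearOne` ((W1)–(W4): the INCLUSIONS `1 + 4𝓂 ⊆ N(K(√u))` for every `u`, `1 + 4𝒪 ⊆ N` for a unit `u`, `U ⊆ N` for
`u ≡ □ (mod 4)`, the even-depth ladder), same define-free currency: a field `K` with `Valued.v : K → ℤᵐ⁰`; «`x ∈ N(K(√u)^×)`» := `∃ a b, a·a − u·(b·b) = x`;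
«`η̄ ∉ ℘(𝓀)`» (`℘(ρ) = ρ² + ρ`, the Artin–Schreier map of the residue field) := `∀ ρ, v ρ ≤ 1 → 1 ≤ v(ρ·ρ + ρ − η)`; a value is «square» when it is `v y · v y` for
some `y : K` (EVEN order).  HONEST LABEL: HC_CM is proved only modulo the 7 printed citations (2 remaining named inputs: hLiu418 = stmt-HodgeConjecture-24832,
h413 = stmt-HodgeConjecture-24833) until rung 0 closes; count-neutral, Mathlib-footed, bankable (no reader this week).

THE MATHEMATICS (`e = ord 2`; NO completeness except in §5 (⇐) and the `F_v` dress):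
* §1 (X1) SYMMETRY `exists_sq_sub_mul_sq_symm` — `x ∈ N(K(√u))`, `x ≠ 0`, `2 ≠ 0 ⇒ u ∈ N(K(√x))` (for `x = a² − ub²` with `b ≠ 0`, `u = (a∕b)² − x(1∕b)²`; for `b = 0`,
  `x = a²` and `c² − a²d²` is hyperbolic): the define-free symmetry of the Hilbert symbol.
* §2 (X2) THE DEPTH OF A SQUARE `valued_mul_self_sub_one_of_lt ∕ _of_gt`, `valued_mul_self_sub_one_eq_sq_of_four_lt` — `a² − 1 = (a − 1)(a − 1 + 2)`: the value is
  `v(a−1)·v 2` if `v(a−1) < v 2`, `v(a−1)²` if `v 2 < v(a−1)`; a depth `> 4` (i.e. `v(a² − 1) > v 4`) is EVEN; `valued_ne_mul_self_of_eq_exp_odd`: `exp(2n+1)` is not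
  a square value.
* §3 (X3) RIGIDITY OF AN ODD DEFECT `valued_sub_one_le_valued_mul_sq_sub_one_of_odd` — `v 4 < v(u − 1)`, `v(u − 1)` not a square value ⇒ `v(u − 1) ≤ v(u·t² − 1)`
  for every unit `t` (`u t² − 1 = (u − 1)t² + (t² − 1)`, summands of DIFFERENT values by (X2)): the ladder ★ (W4) stops exactly at odd depths [O'Meara 63:5].
* §4 (X4) THE EXACT CONDUCTOR `2e + 1` FOR `u` OF ODD ORDER `not_exists_sq_sub_mul_sq_eq_one_add_four_mul` — `v u` not a square value, `v 2 < 1`, `2 ≠ 0`,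
  `η̄ ∉ ℘(𝓀) ⇒ 1 + 4η ∉ N(K(√u)^×)`: `v(a²) ≠ v(u b²)` so `v a = 1` and `x − a² = −u b²` has a NON-square value; but `v(x − a²) = v(4η − (a² − 1))` is `v(a−1)²` or
  `v 4` when `v(a−1) ≠ v 2`, and for `a = 1 + 2ρ` it is `v(4(ρ² + ρ − η)) = v 4` because `η̄ ∉ ℘(𝓀)` — square values; `b = 0` would give `η = ρ² + ρ`.  With ★ (W1)
  (`1 + 4𝓂 ⊆ N`): **`a(K(√u)∕K) = 2e + 1` exactly** [O'Meara 63:11a; `(ϖ, 1 + 4η) = (−1)^{Tr η̄}`]; by (X1) `not_exists_sq_sub_one_add_four_mul_mul_sq_eq`: an element of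
  odd order is not a norm from the UNRAMIFIED `K(√(1 + 4η))`.
* §5 (X5) `exists_artinSchreier_eq_of_mul_self_eq` ∕ `exists_mul_self_eq_one_add_four_mul` — `1 + 4η` is a square iff `η̄ ∈ ℘(𝓀)` (⇐ by the Hensel kernel with
  `b = 1 + 2ρ`); (X6) `exists_forall_one_le_valued_artinSchreier_sub` — for a FINITE residue field of characteristic `2` some `η ∈ 𝒪` has `η̄ ∉ ℘(𝓀)` (`℘` is additive
  with kernel `∋ 0, 1`, so not onto): (X4) is never vacuous at a dyadic place; `…_adicCompletion` dress.
NOT HERE (shelved, L): the general dyadic symbol «`(1 + w, 1 + 4η∕w) = (−1)^{Tr η̄}`, `ord w` odd `< 2e`» = exact conductor `2e + 1 − s` for a unit of odd defect `s`.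

## References
* [Omeara1963] O. T. O'Meara, *Introduction to Quadratic Forms*, Grundlehren 117 (1963), §63A (63:1–63:5: the quadratic defect), §63B (63:9–63:11a: local norms and
  Hilbert symbols at a dyadic spot) — standard numbering, un-paged (book not held by the cell).
* [Serre1979] J.-P. Serre, *Local Fields*, GTM 67 (1979), Ch. V §3; Ch. XIV §§3–4 (local symbols; `(a, b)` at `p = 2`); Ch. XV §2.
* [NeukirchANT1999] J. Neukirch, *Algebraic Number Theory* (1999), Ch. V §3 (the Hilbert symbol at dyadic places).
-/

set_option autoImplicit false

noncomputable section

open scoped Valued WithZero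
open NumberField IsDedekindDomain

namespace Literature.NumberTheory.LocalFields

/-! ## §1 Symmetry of the norm relation -/
section Symmetry
variable {K : Type*} [Field K]

/-- **(X1) SYMMETRY** (the Hilbert symbol is symmetric, define-free): if `x = a·a − u·(b·b)` is a norm from `K(√u)`, `x ≠ 0` and `2 ≠ 0` in `K`, then `u` is a norm
from `K(√x)`: `u = c·c − x·(d·d)` — for `b ≠ 0` take `c = a∕b`, `d = 1∕b`; for `b = 0`, `x = a²` and `c = (u + 1)∕2`, `d = (1 − u)∕(2a)`.
[cite: Omeara1963, §63B 63:9–63:11a] [cite: Serre1979, Ch. XIV §3] -/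
theorem exists_sq_sub_mul_sq_symm (h2 : (2 : K) ≠ 0) {u x : K} (hx0 : x ≠ 0) (h : ∃ a b : K, a * a - u * (b * b) = x) :
    ∃ c d : K, c * c - x * (d * d) = u := by
  obtain ⟨a, b, hab⟩ := h
  by_cases hb : b = 0
  · rw [hb, mul_zero, mul_zero, sub_zero] at hab
    have ha : a ≠ 0 := fun ha => hx0 (by rw [← hab, ha, mul_zero])
    refine ⟨(u + 1) * (2 : K)⁻¹, (1 - u) * (2 * a)⁻¹, ?_⟩
    rw [← hab]
    field_simp
    ring
  · refine ⟨a * b⁻¹, b⁻¹, ?_⟩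
    rw [← hab]
    field_simp
    ring

end Symmetry

/-! ## §2 The depth of a square; parity of values -/
section Depth
variable {K : Type*} [Field K] [Valued K ℤᵐ⁰]

/-- `a² − 1 = (a − 1)(a − 1 + 2)`: if `v(a − 1) < v 2` then `v(a·a − 1) = v(a − 1)·v 2`. [cite: Omeara1963, §63A 63:1–63:5] -/
theorem valued_mul_self_sub_one_of_lt {a : K} (h : Valued.v (a - 1) < Valued.v (2 : K)) :
    Valued.v (a * a - 1) = Valued.v (a - 1) * Valued.v (2 : K) := by
  rw [show a * a - 1 = (a - 1) * (a - 1 + 2) by ring, map_mul, Valuation.map_add_eq_of_lt_right _ h]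

/-- `a² − 1 = (a − 1)(a − 1 + 2)`: if `v 2 < v(a − 1)` then `v(a·a − 1) = v(a − 1)·v(a − 1)` (a square value). [cite: Omeara1963, §63A 63:1–63:5] -/
theorem valued_mul_self_sub_one_of_gt {a : K} (h : Valued.v (2 : K) < Valued.v (a - 1)) :
    Valued.v (a * a - 1) = Valued.v (a - 1) * Valued.v (a - 1) := by
  rw [show a * a - 1 = (a - 1) * (a - 1 + 2) by ring, map_mul, Valuation.map_add_eq_of_lt_left _ h]

/-- **(X2) THE DEPTH OF A SQUARE IS EVEN BELOW `2·ord 2`**: if `v 4 < v(a·a − 1)` then `v 2 < v(a − 1)` and `v(a·a − 1) = v(a − 1)·v(a − 1)` (were `v(a − 1) ≤ v 2`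
both factors of `(a − 1)(a − 1 + 2)` would be `≤ v 2`). [cite: Omeara1963, §63A 63:1–63:5] -/
theorem valued_mul_self_sub_one_eq_sq_of_four_lt {a : K} (h : Valued.v (4 : K) < Valued.v (a * a - 1)) :
    Valued.v (2 : K) < Valued.v (a - 1) ∧ Valued.v (a * a - 1) = Valued.v (a - 1) * Valued.v (a - 1) := by
  have h2a : Valued.v (2 : K) < Valued.v (a - 1) := by
    by_contra hle
    rw [not_lt] at hle
    refine (lt_irrefl _) (h.trans_le ?_)
    rw [show a * a - 1 = (a - 1) * (a - 1 + 2) by ring, map_mul, show (4 : K) = 2 * 2 by norm_num, map_mul]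
    exact mul_le_mul' hle ((Valuation.map_add _ _ _).trans (max_le hle le_rfl))
  exact ⟨h2a, valued_mul_self_sub_one_of_gt h2a⟩

/-- **PARITY**: a value `exp(2n + 1)` (ODD order) is never a square value `v y·v y`. [cite: Omeara1963, §63A 63:2] -/
theorem valued_ne_mul_self_of_eq_exp_odd {u : K} {n : ℤ} (hu : Valued.v u = WithZero.exp (2 * n + 1)) (y : K) : Valued.v u ≠ Valued.v y * Valued.v y := by
  intro h
  rw [hu] at h
  by_cases hy : Valued.v y = 0
  · rw [hy, mul_zero] at h
    exact WithZero.exp_ne_zero h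
  · rw [← WithZero.exp_log hy, ← WithZero.exp_add, WithZero.exp_inj] at h
    omega

/-- From `v u · (v b · v b) = v z · v z` with `b ≠ 0`: `v u = v(z·b⁻¹)·v(z·b⁻¹)` — a square value (private bookkeeping). [cite: Omeara1963, §63A 63:2] -/
private theorem valued_eq_mul_self_div {u b z : K} (hb : b ≠ 0) (h : Valued.v u * (Valued.v b * Valued.v b) = Valued.v z * Valued.v z) :
    Valued.v u = Valued.v (z * b⁻¹) * Valued.v (z * b⁻¹) := by
  have hvb : Valued.v b ≠ 0 := (Valuation.ne_zero_iff _).2 hb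
  have hbb : Valued.v b * Valued.v b ≠ 0 := mul_ne_zero hvb hvb
  calc Valued.v u = Valued.v u * (Valued.v b * Valued.v b) * (Valued.v b * Valued.v b)⁻¹ := by rw [mul_inv_cancel_right₀ hbb]
    _ = Valued.v z * Valued.v z * ((Valued.v b)⁻¹ * (Valued.v b)⁻¹) := by rw [h, mul_inv]
    _ = Valued.v (z * b⁻¹) * Valued.v (z * b⁻¹) := by rw [map_mul, map_inv₀, mul_mul_mul_comm]

/-! ## §3 Rigidity of an odd defect -/

/-- **(X3) AN ODD DEFECT IS RIGID** (the even-depth ladder ★ `exists_valued_mul_sq_sub_one_lt` stops exactly here): if `v 4 < v(u − 1)` and `v(u − 1)` is NOT a square value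
(an ODD depth `s < 2·ord 2`), then `v(u − 1) ≤ v(u·(t·t) − 1)` for every `t` with `v t = 1` — `u t² − 1 = (u − 1)t² + (t² − 1)` with `v(t² − 1) ≤ v 4` or a square
value (X2), never `= v(u − 1)`.  So the quadratic DEFECT of `u` is `𝔭^s`. [cite: Omeara1963, §63A 63:2, 63:5] -/
theorem valued_sub_one_le_valued_mul_sq_sub_one_of_odd {u : K} (h4u : Valued.v (4 : K) < Valued.v (u - 1))
    (hodd : ∀ y : K, Valued.v (u - 1) ≠ Valued.v y * Valued.v y) {t : K} (ht : Valued.v t = 1) :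
    Valued.v (u - 1) ≤ Valued.v (u * (t * t) - 1) := by
  have h1 : Valued.v ((u - 1) * (t * t)) = Valued.v (u - 1) := by rw [map_mul, map_mul, ht, mul_one, mul_one]
  have hne : Valued.v ((u - 1) * (t * t)) ≠ Valued.v (t * t - 1) := by
    rw [h1]
    intro heq
    by_cases hlt : Valued.v (4 : K) < Valued.v (t * t - 1)
    · exact hodd (t - 1) (heq.trans (valued_mul_self_sub_one_eq_sq_of_four_lt hlt).2)
    · exact (lt_irrefl _) (h4u.trans_le (heq.le.trans (not_lt.1 hlt)))
  rw [show u * (t * t) - 1 = (u - 1) * (t * t) + (t * t - 1) by ring, Valuation.map_add_of_distinct_val _ hne, h1]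
  exact le_max_left _ _

/-! ## §4 The exact conductor `2·ord 2 + 1` for `u` of odd order -/

/-- `η̄ ∉ ℘(𝓀)` forces `η` to be a unit (take `ρ = 0`: `1 ≤ v(−η)`). [cite: Omeara1963, §63A 63:3] -/
theorem valued_eq_one_of_forall_one_le_valued_artinSchreier_sub {η : K} (hη1 : Valued.v η ≤ 1)
    (hη : ∀ ρ : K, Valued.v ρ ≤ 1 → 1 ≤ Valued.v (ρ * ρ + ρ - η)) : Valued.v η = 1 := by
  refine le_antisymm hη1 ?_
  have h := hη 0 (by rw [map_zero]; exact zero_le)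
  rwa [mul_zero, zero_add, zero_sub, Valuation.map_neg] at h

/-- **(X5, ⇒) A SQUARE `1 + 4η` HAS `η ∈ ℘(𝒪)`**: if `2 ≠ 0`, `v η ≤ 1` and `r·r = 1 + 4η` then `η = ρ·ρ + ρ` for some `ρ` with `v ρ ≤ 1` — `ρ = (r − 1)∕2`, and
`v(r − 1) ≤ v 2` because otherwise `v(r² − 1) = v(r − 1)² > v 4 ≥ v(4η)` (X2).  No completeness. [cite: Omeara1963, §63A 63:3] [cite: Serre1979, Ch. XIV §4] -/
theorem exists_artinSchreier_eq_of_mul_self_eq (h2 : (2 : K) ≠ 0) {r η : K} (hη1 : Valued.v η ≤ 1) (hr : r * r = 1 + 4 * η) :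
    ∃ ρ : K, Valued.v ρ ≤ 1 ∧ ρ * ρ + ρ = η := by
  have hv2 : Valued.v (2 : K) ≠ 0 := (Valuation.ne_zero_iff _).2 h2
  have hle : Valued.v (r - 1) ≤ Valued.v (2 : K) := by
    by_contra hgt
    rw [not_le] at hgt
    have h1 : Valued.v (r * r - 1) = Valued.v (r - 1) * Valued.v (r - 1) := valued_mul_self_sub_one_of_gt hgt
    have h2' : Valued.v (r * r - 1) ≤ Valued.v (2 : K) * Valued.v (2 : K) := by
      rw [hr, add_sub_cancel_left, map_mul, show (4 : K) = 2 * 2 by norm_num, map_mul]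
      exact mul_le_of_le_one_right' hη1
    refine (lt_irrefl (Valued.v (2 : K) * Valued.v (2 : K))) (lt_of_lt_of_le ?_ (h1 ▸ h2'))
    calc Valued.v (2 : K) * Valued.v (2 : K) < Valued.v (r - 1) * Valued.v (2 : K) := mul_lt_mul_of_pos_right hgt (zero_lt_iff.2 hv2)
      _ < Valued.v (r - 1) * Valued.v (r - 1) := mul_lt_mul_of_pos_left hgt (zero_lt_iff.2 (ne_of_gt ((zero_lt_iff.2 hv2).trans hgt)))
  refine ⟨(r - 1) * (2 : K)⁻¹, ?_, ?_⟩
  · rw [map_mul, map_inv₀]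
    calc Valued.v (r - 1) * (Valued.v (2 : K))⁻¹ ≤ Valued.v (2 : K) * (Valued.v (2 : K))⁻¹ := mul_le_mul_left hle _
      _ = 1 := mul_inv_cancel₀ hv2
  · field_simp
    linear_combination hr

/-- **(X5, ⇐) `η̄ ∈ ℘(𝓀)` MAKES `1 + 4η` A SQUARE** (complete `K`, `v 2 < 1`): if `v ρ ≤ 1` and `v(ρ·ρ + ρ − η) < 1` then `r·r = 1 + 4η` for some `r` — the Hensel kernel ★
`exists_valued_lt_one_mul_self_add_mul_eq` with the unit `b = 1 + 2ρ` and `c = η − (ρ² + ρ) ∈ 𝓂` gives `δ`, and `r = 1 + 2(ρ + δ)`.  (So for `u` of odd order the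
norm group of `K(√u)` meets `1 + 4𝒪` exactly in `1 + 4·℘⁻¹`-classes: these `1 + 4η` are squares.) [cite: Omeara1963, §63A 63:3] [cite: Serre1979, Ch. XIV §4] -/
theorem exists_mul_self_eq_one_add_four_mul [IsAdicComplete 𝓂[K] 𝒪[K]] (h2v : Valued.v (2 : K) < 1) {ρ η : K} (hρ1 : Valued.v ρ ≤ 1)
    (hρ : Valued.v (ρ * ρ + ρ - η) < 1) : ∃ r : K, r * r = 1 + 4 * η := by
  have hb : Valued.v (1 + 2 * ρ) = 1 := by
    refine Valuation.map_one_add_of_lt _ ?_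
    rw [map_mul]
    exact (mul_le_of_le_one_right' hρ1).trans_lt h2v
  have hc : Valued.v (η - (ρ * ρ + ρ)) < 1 := by rwa [Valuation.map_sub_swap]
  obtain ⟨δ, -, hδ⟩ := exists_valued_lt_one_mul_self_add_mul_eq hb hc
  exact ⟨1 + 2 * (ρ + δ), by linear_combination (4 : K) * hδ⟩

/-- THE KEY STEP of (X4) (private): for `2 ≠ 0` and a unit `η` with `η̄ ∉ ℘(𝓀)`, the difference `(1 + 4η) − a·a` has a SQUARE value for EVERY `a` — `v 2·v 2` if
`v(a − 1) < v 2` (the square term is shallower than `4η`), `v(a − 1)²` if `v 2 < v(a − 1)` (it is deeper), and `v 2·v 2` for `a = 1 + 2ρ`, where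
`(1 + 4η) − a² = −4(ρ² + ρ − η)` and `ρ² + ρ − η` is a UNIT because `η̄ ∉ ℘(𝓀)`. [cite: Omeara1963, §63B 63:11a] -/
private theorem exists_valued_one_add_four_mul_sub_mul_self_eq_sq (h2 : (2 : K) ≠ 0) {η : K}
    (hη : ∀ ρ : K, Valued.v ρ ≤ 1 → 1 ≤ Valued.v (ρ * ρ + ρ - η)) (hηu : Valued.v η = 1) (a : K) :
    ∃ z : K, Valued.v (1 + 4 * η - a * a) = Valued.v z * Valued.v z := by
  have hv2 : Valued.v (2 : K) ≠ 0 := (Valuation.ne_zero_iff _).2 h2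
  have h4η : Valued.v (4 * η) = Valued.v (2 : K) * Valued.v (2 : K) := by
    rw [map_mul, hηu, mul_one, show (4 : K) = 2 * 2 by norm_num, map_mul]
  have hre : 1 + 4 * η - a * a = 4 * η - (a * a - 1) := by ring
  rcases lt_trichotomy (Valued.v (a - 1)) (Valued.v (2 : K)) with hlt | heq | hgt
  · -- shallow square term: `v(a² − 1) = v(a − 1)·v 2 < v 2·v 2 = v(4η)`
    refine ⟨2, ?_⟩
    have h' : Valued.v (a * a - 1) < Valued.v (4 * η) := by
      rw [valued_mul_self_sub_one_of_lt hlt, h4η]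
      exact mul_lt_mul_of_pos_right hlt (zero_lt_iff.2 hv2)
    rw [hre, Valuation.map_sub_eq_of_lt_left _ h', h4η]
  · -- `a = 1 + 2ρ`, `ρ ∈ 𝒪`: `(1 + 4η) − a² = −4(ρ² + ρ − η)`, a unit times `4`
    refine ⟨2, ?_⟩
    set ρ : K := (a - 1) * (2 : K)⁻¹ with hρ
    have hρ1 : Valued.v ρ ≤ 1 := by
      rw [hρ, map_mul, map_inv₀, heq, mul_inv_cancel₀ hv2]
    have hunit : Valued.v (ρ * ρ + ρ - η) = 1 := by
      refine le_antisymm ?_ (hη ρ hρ1)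
      refine Valuation.map_sub_le _ (Valuation.map_add_le _ ?_ hρ1) hηu.le
      rw [map_mul]
      exact mul_le_one' hρ1 hρ1
    have hid : 1 + 4 * η - a * a = -(4 * (ρ * ρ + ρ - η)) := by
      rw [hρ]
      field_simp
      ring
    rw [hid, Valuation.map_neg, map_mul, hunit, mul_one, show (4 : K) = 2 * 2 by norm_num, map_mul]
  · -- deep square term: `v(a² − 1) = v(a − 1)² > v(4η)`
    refine ⟨a - 1, ?_⟩
    have h' : Valued.v (4 * η) < Valued.v (a * a - 1) := by
      rw [valued_mul_self_sub_one_of_gt hgt, h4η]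
      calc Valued.v (2 : K) * Valued.v (2 : K) < Valued.v (a - 1) * Valued.v (2 : K) := mul_lt_mul_of_pos_right hgt (zero_lt_iff.2 hv2)
        _ < Valued.v (a - 1) * Valued.v (a - 1) := mul_lt_mul_of_pos_left hgt (zero_lt_iff.2 (ne_of_gt ((zero_lt_iff.2 hv2).trans hgt)))
    rw [hre, Valuation.map_sub_eq_of_lt_right _ h', valued_mul_self_sub_one_of_gt hgt]

/-- **(X4) THE EXACT CONDUCTOR `2·ord 2 + 1` FOR `u` OF ODD ORDER.**  Let `2 ≠ 0`, `v 2 < 1` (residue characteristic `2`), let `v u` be NOT a square value (`v u ≠ v y·v y`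
for all `y`: `u` has odd order, e.g. `u = ϖ·unit`, cf. `valued_ne_mul_self_of_eq_exp_odd`), and let `η ∈ 𝒪` with `η̄ ∉ ℘(𝓀) = {ρ̄² + ρ̄}` (define-free:
`1 ≤ v(ρ·ρ + ρ − η)` for all `ρ ∈ 𝒪`).  Then `1 + 4η` is NOT a norm from `K(√u)`: there are no `a, b` with `a·a − u·(b·b) = 1 + 4η`.  Hence, with ★ (W1)
`exists_sq_sub_mul_sq_eq_of_valued_sub_one_lt_four` (`1 + 4𝓂 ⊆ N`), the conductor of `K(√u)∕K` is EXACTLY `2·ord 2 + 1` [classically `(ϖ, 1 + 4η)_𝔭 = (−1)^{Tr η̄}`].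
Proof: `(1 + 4η) − a² = −u b²` has the NON-square value `v u·(v b)²` if `b ≠ 0`, contradicting the private square-value dichotomy; if `b = 0` then `1 + 4η = a²`
and (X5 ⇒) gives `η = ρ² + ρ` with `ρ ∈ 𝒪`, against `η̄ ∉ ℘(𝓀)`. [cite: Omeara1963, §63B 63:11a] [cite: Serre1979, Ch. XIV §4] [cite: NeukirchANT1999, Ch. V §3] -/
theorem not_exists_sq_sub_mul_sq_eq_one_add_four_mul (h2 : (2 : K) ≠ 0) {u : K} (hu : ∀ y : K, Valued.v u ≠ Valued.v y * Valued.v y)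
    {η : K} (hη1 : Valued.v η ≤ 1) (hη : ∀ ρ : K, Valued.v ρ ≤ 1 → 1 ≤ Valued.v (ρ * ρ + ρ - η)) :
    ¬ ∃ a b : K, a * a - u * (b * b) = 1 + 4 * η := by
  rintro ⟨a, b, hab⟩
  have hηu : Valued.v η = 1 := valued_eq_one_of_forall_one_le_valued_artinSchreier_sub hη1 hη
  by_cases hb : b = 0
  · rw [hb, mul_zero, mul_zero, sub_zero] at hab
    obtain ⟨ρ, hρ1, hρ⟩ := exists_artinSchreier_eq_of_mul_self_eq h2 hη1 hab
    have h := hη ρ hρ1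
    rw [hρ, sub_self, map_zero] at h
    exact not_lt.2 h zero_lt_one
  · obtain ⟨z, hz⟩ := exists_valued_one_add_four_mul_sub_mul_self_eq_sq h2 hη hηu a
    have hdiff : 1 + 4 * η - a * a = -(u * (b * b)) := by rw [← hab]; ring
    rw [hdiff, Valuation.map_neg, map_mul, map_mul] at hz
    exact hu (z * b⁻¹) (valued_eq_mul_self_div hb hz)

/-- **(X4′) BY SYMMETRY: an element of odd order is NOT a norm from the UNRAMIFIED `K(√(1 + 4η))`** (`η̄ ∉ ℘(𝓀)`; `2 ≠ 0`): no `c, d` with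
`c·c − (1 + 4η)·(d·d) = u` when `v u` is not a square value — (X1) turns such a representation into `1 + 4η ∈ N(K(√u))`, excluded by (X4).  (The norm group of the
unramified quadratic extension is exactly the elements of EVEN order: ⊇ by ★ `UnramifiedQuadraticNorm…`∕(W3), ⊉ odd order here.) [cite: Omeara1963, §63A 63:3; §63B 63:11a]
[cite: Serre1979, Ch. V §3; Ch. XIV §4] -/
theorem not_exists_sq_sub_one_add_four_mul_mul_sq_eq (h2 : (2 : K) ≠ 0) {u : K} (hu : ∀ y : K, Valued.v u ≠ Valued.v y * Valued.v y)
    {η : K} (hη1 : Valued.v η ≤ 1) (hη : ∀ ρ : K, Valued.v ρ ≤ 1 → 1 ≤ Valued.v (ρ * ρ + ρ - η)) :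
    ¬ ∃ c d : K, c * c - (1 + 4 * η) * (d * d) = u := by
  intro h
  have hu0 : u ≠ 0 := fun h0 => hu 0 (by rw [h0, map_zero, mul_zero])
  exact not_exists_sq_sub_mul_sq_eq_one_add_four_mul h2 hu hη1 hη (exists_sq_sub_mul_sq_symm h2 hu0 h)

end Depth

/-! ## §5 A residue class outside `℘(𝓀)` exists when the residue field is finite of characteristic `2` -/
section Residue
variable {K : Type*} [Field K] [Valued K ℤᵐ⁰]

/-- **(X6) `℘(𝓀) ≠ 𝓀` FOR A FINITE RESIDUE FIELD OF CHARACTERISTIC `2`**: if `𝓀[K]` is finite and `v 2 < 1` then some `η ∈ 𝒪[K]` has `η̄ ∉ ℘(𝓀)`, define-free: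
`1 ≤ v(ρ·ρ + ρ − η)` for every `ρ ∈ 𝒪[K]` (the Artin–Schreier map `ρ̄ ↦ ρ̄² + ρ̄` kills `0` and `1 ≠ 0`, so it is not injective, hence — `𝓀` being finite — not onto).
So (X4) is never vacuous at a dyadic place: `1 + 4𝒪 ⊄ N(K(√u)^×)` for every `u` of odd order. [cite: Serre1979, Ch. XIV §4] [cite: NeukirchANT1999, Ch. V §3] -/
theorem exists_forall_one_le_valued_artinSchreier_sub [Finite 𝓀[K]] (h2v : Valued.v (2 : K) < 1) :
    ∃ η : K, Valued.v η ≤ 1 ∧ ∀ ρ : K, Valued.v ρ ≤ 1 → 1 ≤ Valued.v (ρ * ρ + ρ - η) := by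
  have h2M : (2 : 𝒪[K]) ∈ 𝓂[K] := by
    rw [Valued.maximalIdeal, IsLocalRing.mem_maximalIdeal, mem_nonunits_iff, Valuation.Integer.not_isUnit_iff_valuation_lt_one]
    exact_mod_cast h2v
  have h2k : (2 : 𝓀[K]) = 0 := by
    have h := (IsLocalRing.residue_eq_zero_iff (2 : 𝒪[K])).2 h2M
    rwa [map_ofNat] at h
  -- the Artin–Schreier map of the residue field is not injective (`℘ 0 = ℘ 1 = 0`), hence not surjective
  set AS : 𝓀[K] → 𝓀[K] := fun r => r * r + r with hAS
  have hnotinj : ¬ Function.Injective AS := by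
    intro hinj
    have h01 : AS 0 = AS 1 := by
      simp only [hAS, mul_zero, zero_add, mul_one]
      rw [show (1 : 𝓀[K]) + 1 = 2 by norm_num, h2k]
    exact zero_ne_one (hinj h01)
  have hnotsurj : ¬ Function.Surjective AS := fun hs => hnotinj (Finite.injective_iff_surjective.2 hs)
  obtain ⟨e, he⟩ := not_forall.1 (fun hall => hnotsurj hall)
  obtain ⟨ηO, hηO⟩ := IsLocalRing.residue_surjective e
  refine ⟨ηO, ηO.2, fun ρ hρ => ?_⟩
  have hρO : ρ ∈ 𝒪[K] := (Valuation.mem_integer_iff _ _).2 hρ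
  set ρO : 𝒪[K] := ⟨ρ, hρO⟩ with hρO_def
  -- `ρO² + ρO − ηO ∉ 𝓂`: its residue is `℘(ρ̄) − e ≠ 0`
  have hnot : ρO * ρO + ρO - ηO ∉ 𝓂[K] := by
    rw [Valued.maximalIdeal, ← IsLocalRing.residue_eq_zero_iff, map_sub, map_add, map_mul, hηO, sub_eq_zero]
    exact fun h => he ⟨IsLocalRing.residue 𝒪[K] ρO, h⟩
  rw [Valued.maximalIdeal, IsLocalRing.mem_maximalIdeal, mem_nonunits_iff, not_not,
    (Valuation.integer.integers (Valued.v (R := K))).isUnit_iff_valuation_eq_one] at hnot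
  have hval : Valued.v (ρ * ρ + ρ - (ηO : K)) = 1 := by exact_mod_cast hnot
  exact hval.ge

end Residue

/-! ## §6 The completion `F_v` of a number field at a dyadic place -/
section AdicCompletion
variable (F : Type*) [Field F] [NumberField F] (v : HeightOneSpectrum (𝓞 F))

/-- **(X4)+(X6) AT A DYADIC PLACE `v` OF A NUMBER FIELD** (`v(2) < 1` in `F_v`): there is `η ∈ 𝒪_v` such that for EVERY `u ∈ F_v` of odd order (`v u` not a square value)
`1 + 4η ∉ N(F_v(√u)^×)` — together with ★ (W1) the conductor of every such `F_v(√u)∕F_v` is exactly `2·ord_v 2 + 1`; and `u ∉ N(F_v(√(1 + 4η))^×)` (the unramified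
quadratic extension has no norms of odd order). [cite: Omeara1963, §63B 63:11a] [cite: Serre1979, Ch. XIV §4] [cite: NeukirchANT1999, Ch. V §3] -/
theorem exists_forall_not_exists_sq_sub_mul_sq_adicCompletion (h2v : Valued.v (2 : v.adicCompletion F) < 1) :
    ∃ η : v.adicCompletion F, Valued.v η ≤ 1 ∧ ∀ u : v.adicCompletion F, (∀ y : v.adicCompletion F, Valued.v u ≠ Valued.v y * Valued.v y) →
      (¬ ∃ a b : v.adicCompletion F, a * a - u * (b * b) = 1 + 4 * η) ∧ ¬ ∃ c d : v.adicCompletion F, c * c - (1 + 4 * η) * (d * d) = u := by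
  haveI : Finite 𝓀[v.adicCompletion F] := Literature.NumberTheory.Automorphic.finite_residueField_adicCompletion F v
  have h2 : (2 : v.adicCompletion F) ≠ 0 := by
    rw [show (2 : v.adicCompletion F) = algebraMap F (v.adicCompletion F) 2 by rw [map_ofNat]]
    exact (_root_.map_ne_zero (algebraMap F (v.adicCompletion F))).2 two_ne_zero
  obtain ⟨η, hη1, hη⟩ := exists_forall_one_le_valued_artinSchreier_sub h2v
  exact ⟨η, hη1, fun u hu => ⟨not_exists_sq_sub_mul_sq_eq_one_add_four_mul h2 hu hη1 hη, not_exists_sq_sub_one_add_four_mul_mul_sq_eq h2 hu hη1 hη⟩⟩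

/-- **(X3) AT A DYADIC PLACE**: rigidity of an odd defect in `F_v` — `v 4 < v(u − 1)`, `v(u − 1)` not a square value, `v t = 1 ⇒ v(u − 1) ≤ v(u·t² − 1)` (valuation only; stated for
the record next to ★ `exists_valued_mul_sq_sub_one_lt_adicCompletion`). [cite: Omeara1963, §63A 63:5] -/
theorem valued_sub_one_le_valued_mul_sq_sub_one_of_odd_adicCompletion {u : v.adicCompletion F} (h4u : Valued.v (4 : v.adicCompletion F) < Valued.v (u - 1))
    (hodd : ∀ y : v.adicCompletion F, Valued.v (u - 1) ≠ Valued.v y * Valued.v y) {t : v.adicCompletion F} (ht : Valued.v t = 1) :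
    Valued.v (u - 1) ≤ Valued.v (u * (t * t) - 1) :=
  valued_sub_one_le_valued_mul_sq_sub_one_of_odd h4u hodd ht

end AdicCompletion

end Literature.NumberTheory.LocalFields

end
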